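import Mathlib.Topology.UniformSpace.Equicontinuity
import Mathlib.Topology.UniformSpace.HeineCantor
import HarnessLib

/-!
# The Auslander–Yorke dichotomy: a minimal system is either equicontinuous or sensitive

Topic `Literature/Dynamics/TopologicalDynamics` (companion of `UniformRecurrence.lean` and
`MinimalOrbitClosure.lean`; theorems only, no definitions).  For an action `ϕ : G → X → X` of an
additive GROUP of times on a uniform space `X`, given as a bare family of maps with the action law
`ϕ (s + t) = ϕ s ∘ ϕ t` and separate continuity (so that the results apply verbatim to a Mathlib
`Flow`, to `AddAction` instances and to set-theoretic actions such as the Navier–Stokes scaling flow on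
fields):

* `equicontinuousAt_of_dense_orbit_of_not_sensitive` — if the action is NOT SENSITIVE (for every
  entourage `V` some point `x` has a neighbourhood all of whose points stay `V`-close to `x` along the
  whole orbit) then every point with a DENSE ORBIT is an equicontinuity point of the family of maps
  `(ϕ t)_{t ∈ G}` (Mathlib `EquicontinuousAt`).  This is the group-action form of Akin–Auslander–Berg
  1996, Thm. 2.4 ("a transitive system that is not sensitive is almost equicontinuous: the transitive
  points are equicontinuity points"); the proof is theirs: a good neighbourhood `U` of `x` for a
  half-size symmetric entourage, a time `s` with `ϕ s z ∈ U`, and the neighbourhood `(ϕ s)⁻¹ U` of `z`,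
  transported along the orbit by the action law `ϕ t = ϕ (t - s) ∘ ϕ s`.
* `not_equicontinuousAt_of_sensitive` — conversely a sensitive action has no equicontinuity point.
* `equicontinuous_or_sensitive_of_dense_orbits` — **the Auslander–Yorke dichotomy** (Auslander–Yorke
  1980, Cor. 2 of Thm. 1 for maps; Glasner 2003, Thm. 1.41): if every orbit is dense (the action is
  MINIMAL) then either the family `(ϕ t)_t` is equicontinuous at every point, or the action is
  sensitive; on a compact phase space the first alternative is uniform equicontinuity
  (`uniformEquicontinuous_or_sensitive_of_dense_orbits`, via Mathlib's
  `CompactSpace.uniformEquicontinuous_of_equicontinuous`).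

## Design notes

* Sensitivity is written inline as
  `∃ V ∈ 𝓤 X, ∀ x, ∀ U ∈ 𝓝 x, ∃ y ∈ U, ∃ t, (ϕ t x, ϕ t y) ∉ V` (Auslander–Yorke's "sensitive
  dependence on initial conditions", Devaney's chaos ingredient); no new definition is introduced.
* Only separate continuity `∀ t, Continuous (ϕ t)` and the action law are used; the group structure
  enters through `t = (t - s) + s` (for monoid actions the statement fails: one-sided shifts).
* Mathlib (this pin) has `EquicontinuousAt` / `Equicontinuous` / `UniformEquicontinuous`, minimal
  ACTIONS (`AddAction.IsMinimal`) and `Flow`, but no sensitivity and no form of this dichotomy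
  (searched `sensitive`, `Sensitive`, `expansive`, `IsMinimal`): nothing here duplicates Mathlib.

## References

* J. Auslander, J. A. Yorke, *Interval maps, factors of maps, and chaos*, Tôhoku Math. J. 32 (1980),
  177–188, doi:10.2748/tmj/1178229634, Thm. 1 and its corollaries ("a minimal flow is either
  equicontinuous or has sensitive dependence on initial conditions"). [AuslanderYorke1980]
* E. Akin, J. Auslander, K. Berg, *When is a transitive map chaotic?*, in: Convergence in Ergodic
  Theory and Probability (Columbus, OH, 1993), de Gruyter (1996), 25–40, Thm. 2.4, Cor. 2.5. [AkinAuslanderBerg1996]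
* E. Glasner, *Ergodic Theory via Joinings*, AMS (2003), Ch. 1, Thm. 1.41. [Glasner2003]
-/

open Set Filter Function Topology
open scoped Uniformity

namespace Literature.Dynamics.TopologicalDynamics

variable {G : Type*} {X : Type*} [AddGroup G] [UniformSpace X]

/-- **Not sensitive ⇒ points with dense orbit are equicontinuity points** (Akin–Auslander–Berg 1996,
Thm. 2.4, for group actions by continuous maps on a uniform space).  If for every entourage `V` some
point `x` has a neighbourhood `U` with `(ϕ t x, ϕ t y) ∈ V` for all `y ∈ U` and all times `t`, then at
every point `z` whose orbit is dense the family `(ϕ t)_{t ∈ G}` is equicontinuous.  Proof: given an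
entourage `W` take a symmetric `V` with `V ○ V ⊆ W` and its good pair `(x, U)`; by density some `ϕ s z`
lies in the interior of `U`, so `N = (ϕ s)⁻¹ U ∈ 𝓝 z`; for `y ∈ N` and any `t`,
`ϕ t = ϕ (t - s) ∘ ϕ s` and both `ϕ s z, ϕ s y ∈ U` are `V`-close to `ϕ (t - s) x` at time `t - s`.
[cite: AkinAuslanderBerg1996, Thm. 2.4] -/
theorem equicontinuousAt_of_dense_orbit_of_not_sensitive {ϕ : G → X → X}
    (hcont : ∀ t, Continuous (ϕ t)) (hadd : ∀ s t x, ϕ (s + t) x = ϕ s (ϕ t x))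
    (hns : ∀ V ∈ 𝓤 X, ∃ x : X, ∃ U ∈ 𝓝 x, ∀ y ∈ U, ∀ t : G, (ϕ t x, ϕ t y) ∈ V)
    {z : X} (hz : Dense (range fun t => ϕ t z)) :
    EquicontinuousAt (fun t : G => ϕ t) z := by
  intro W hW
  obtain ⟨V, hV, hVsymm, hVW⟩ := comp_symm_mem_uniformity_sets hW
  obtain ⟨x, U, hU, hgood⟩ := hns V hV
  -- an open neighbourhood `U' ⊆ U` of `x`, visited by the orbit of `z`
  obtain ⟨U', hU'U, hU'open, hxU'⟩ := mem_nhds_iff.1 hU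
  obtain ⟨_, ⟨s, rfl⟩, hyU'⟩ := hz.exists_mem_open hU'open ⟨x, hxU'⟩
  -- the neighbourhood `(ϕ s)⁻¹ U'` of `z`
  have hN : (ϕ s) ⁻¹' U' ∈ 𝓝 z := (hU'open.preimage (hcont s)).mem_nhds hyU'
  filter_upwards [hN] with y hy t
  -- transport along the orbit: `ϕ t = ϕ (t - s) ∘ ϕ s`
  have hsplit : ∀ w : X, ϕ t w = ϕ (t - s) (ϕ s w) := fun w => by
    rw [← hadd, sub_add_cancel]
  have h1 : (ϕ (t - s) x, ϕ t z) ∈ V := by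
    rw [hsplit z]
    exact hgood _ (hU'U hyU') _
  have h2 : (ϕ (t - s) x, ϕ t y) ∈ V := by
    rw [hsplit y]
    exact hgood _ (hU'U hy) _
  haveI := hVsymm
  exact hVW (SetRel.prodMk_mem_comp (SetRel.symm V h1) h2)

omit [AddGroup G] in
/-- **A sensitive action has no equicontinuity point**: if some entourage `V` is escaped from every
neighbourhood of every point along the orbits, then no point is an equicontinuity point of
`(ϕ t)_t` (any family of maps; no continuity, no action law). [cite: AuslanderYorke1980, Thm. 1] -/
theorem not_equicontinuousAt_of_sensitive {ϕ : G → X → X} {V : SetRel X X} (hV : V ∈ 𝓤 X)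
    (hsens : ∀ x : X, ∀ U ∈ 𝓝 x, ∃ y ∈ U, ∃ t : G, (ϕ t x, ϕ t y) ∉ V) (x : X) :
    ¬ EquicontinuousAt (fun t : G => ϕ t) x := by
  intro hx
  obtain ⟨y, hy, t, hty⟩ := hsens x _ (hx V hV)
  exact hty (hy t)

/-- **The Auslander–Yorke dichotomy** (Auslander–Yorke 1980; Akin–Auslander–Berg 1996, Cor. 2.5;
Glasner 2003, Thm. 1.41): for a group action by continuous maps with the action law on a uniform
space in which EVERY orbit is dense (a minimal action), either the family `(ϕ t)_{t ∈ G}` is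
equicontinuous (at every point), or the action is sensitive: some entourage `V` is escaped, from every
neighbourhood of every point, by some pair of orbits at some time.  The alternatives are exclusive when
`X` is nonempty (`not_equicontinuousAt_of_sensitive`). [cite: AuslanderYorke1980, Thm. 1 and Cor.; AkinAuslanderBerg1996, Cor. 2.5; Glasner2003, Thm. 1.41] -/
theorem equicontinuous_or_sensitive_of_dense_orbits {ϕ : G → X → X}
    (hcont : ∀ t, Continuous (ϕ t)) (hadd : ∀ s t x, ϕ (s + t) x = ϕ s (ϕ t x))
    (hmin : ∀ z : X, Dense (range fun t => ϕ t z)) :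
    Equicontinuous (fun t : G => ϕ t) ∨
      ∃ V ∈ 𝓤 X, ∀ x : X, ∀ U ∈ 𝓝 x, ∃ y ∈ U, ∃ t : G, (ϕ t x, ϕ t y) ∉ V := by
  by_cases hsens : ∃ V ∈ 𝓤 X, ∀ x : X, ∀ U ∈ 𝓝 x, ∃ y ∈ U, ∃ t : G, (ϕ t x, ϕ t y) ∉ V
  · exact Or.inr hsens
  · left
    push Not at hsens
    exact fun z => equicontinuousAt_of_dense_orbit_of_not_sensitive hcont hadd hsens (hmin z)

/-- **Compact form of the dichotomy**: on a compact uniform space, a minimal group action by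
continuous maps is either UNIFORMLY equicontinuous or sensitive (Auslander–Yorke 1980: "a compact
minimal flow is either equicontinuous or sensitive"; uniformity from Mathlib's
`CompactSpace.uniformEquicontinuous_of_equicontinuous`). [cite: AuslanderYorke1980, Thm. 1 and Cor.; Glasner2003, Thm. 1.41] -/
theorem uniformEquicontinuous_or_sensitive_of_dense_orbits [CompactSpace X] {ϕ : G → X → X}
    (hcont : ∀ t, Continuous (ϕ t)) (hadd : ∀ s t x, ϕ (s + t) x = ϕ s (ϕ t x))
    (hmin : ∀ z : X, Dense (range fun t => ϕ t z)) :
    UniformEquicontinuous (fun t : G => ϕ t) ∨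
      ∃ V ∈ 𝓤 X, ∀ x : X, ∀ U ∈ 𝓝 x, ∃ y ∈ U, ∃ t : G, (ϕ t x, ϕ t y) ∉ V :=
  (equicontinuous_or_sensitive_of_dense_orbits hcont hadd hmin).imp_left
    CompactSpace.uniformEquicontinuous_of_equicontinuous

end Literature.Dynamics.TopologicalDynamics
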